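import Literature.Geometry.Lorentzian.Stationary
import Literature.Geometry.Lorentzian.KillingComovingChart
import Literature.Geometry.Manifold.FlowBox
import Mathlib.Analysis.InnerProductSpace.Projection.Reflection
import HarnessLib

/-!
# Müller zum Hagen 1970, step 1: comoving (stationary) charts of a stationary black-hole spacetime

Support file (everything proved; no definitions, no named facts) towards the named fact
`Literature.Geometry.Lorentzian.mullerZumHagen1970_analytic_of_timelikeKilling`
(`MullerZumHagenAnalyticity.lean`): H. Müller zum Hagen, Proc. Camb. Phil. Soc. 68 (1970)
199–201; the printed proof is restated in P. Tod, Gen. Rel. Grav. 39 (2007) 1031 =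
arXiv:0704.2508, §3.1, whose first step is

> **Theorem 3.1 (Müller zum Hagen).** If a stationary space-time is `C⁵`, with the Killing vector
> `K` being `C⁴`, and the metric `C³`, then there is a `C⁴` atlas with
> `g = F(dt + A_i dx^i)² − h_{ij} dx^i dx^j` with `F`, `A_i` and `h_{ij}` all `C³`
> [and independent of `t`, `K = ∂_t`].

In the setting of the named fact (a `StationaryAFBlackHole` carrier, `K` of class `C^∞` on an
open set `U` and Killing there) this file proves that statement in chart-free form, with the
Killing field straightened to the FIRST coordinate vector `𝐞₀ = EuclideanSpace.single 0 1` of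
`E4 = ℝ⁴` (Lee 2012, Thm. 9.22: flow box, then a linear change of coordinates taking `K y` to the
first basis vector):

* `exists_continuousLinearEquiv_apply_eq` — a non-zero vector of a finite-dimensional inner
  product space is taken to any given unit vector by a continuous linear automorphism
  (a dilation followed by a reflection, Mathlib's `Submodule.reflection_sub`);
* `transHomeomorph_continuousLinearEquiv_mem_maximalAtlas` — a chart of the maximal `C^∞` atlas
  followed by a continuous linear automorphism of the model space stays in the maximal atlas;
* `StationaryAFBlackHole.exists_comovingChart` — about every `y ∈ U` with `K y ≠ 0` there is a
  chart `ψ` of the maximal `C^∞` atlas, `y ∈ ψ.source ⊆ U`, in which `K` is the coordinate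
  field `∂₀` (`dψ_x(K x) = 𝐞₀` and `d(ψ⁻¹)_{ψ x} 𝐞₀ = K x` on `ψ.source`) and in which **every
  metric component `g(∂_a, ∂_b)` has derivative `0` along `𝐞₀` at every point of `ψ.target`**
  (`PseudoRiemannianMetric.hasDerivAt_val_coordVector_of_killing_at`: compatibility, no torsion,
  `[∂₀, ∂_a] = 0`, Killing equation);
* `StationaryAFBlackHole.exists_comovingChart_of_timelike` — the same about every point where
  `K` is timelike (`g(K, K) < 0`, the hypothesis of the named fact);
* `StationaryAFBlackHole.val_coordVector_eq_of_segment` — integrated form: in such a chart the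
  metric components are **constant along every segment `q + [0, t] (EuclideanSpace.single (0 : Fin 4) (1 : ℝ) : E4) ⊆ ψ.target`**, i.e. the
  metric is stationary (independent of the coordinate `x⁰`) in the chart.

What remains of the printed proof (Tod 2007, §3.1 after Thm. 3.1): harmonic time and harmonic
spatial coordinates on the quotient (local solvability of linear elliptic equations), the vacuum
equations as an analytic quasilinear elliptic system in that gauge, and Morrey's analyticity
theorem (Amer. J. Math. 80 (1958) 198–237).

## References

* H. Müller zum Hagen, Proc. Camb. Phil. Soc. 68 (1970) 199–201. [MullerZumHagen1970]
* P. Tod, Gen. Rel. Grav. 39 (2007) 1031–1040, Thm. 3.1 (arXiv:0704.2508, §3.1).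
* J. M. Lee, *Introduction to Smooth Manifolds*, 2nd ed. (2012), Thm. 9.22. [LeeSmoothManifolds2013]
* B. O'Neill, *Semi-Riemannian geometry* (1983), Ch. 9, Prop. 9.23, 9.25. [ONeill1983]
-/

noncomputable section

open Bundle Set Filter Function
open scoped Manifold ContDiff Topology

namespace Literature.Geometry.Lorentzian

/-! ### Two lemmas of linear algebra / differential topology -/

section LinearStraightening

variable {F : Type*} [NormedAddCommGroup F] [InnerProductSpace ℝ F] [FiniteDimensional ℝ F]

/-- A non-zero vector `c` of a finite-dimensional real inner product space is taken to any unit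
vector `e` by a continuous linear automorphism: the dilation by `‖c‖⁻¹` followed by the reflection
exchanging `‖c‖⁻¹ c` and `e` (Mathlib's `Submodule.reflection_sub`). [folklore] -/
theorem exists_continuousLinearEquiv_apply_eq {c : F} (hc : c ≠ 0) {e : F} (he : ‖e‖ = 1) :
    ∃ T : F ≃L[ℝ] F, T c = e := by
  have hc' : ‖c‖ ≠ 0 := norm_ne_zero_iff.2 hc
  set c₁ : F := ‖c‖⁻¹ • c with hc₁
  have hnorm : ‖c₁‖ = ‖e‖ := by
    rw [hc₁, norm_smul, norm_inv, norm_norm, inv_mul_cancel₀ hc', he]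
  set R : F ≃ₗᵢ[ℝ] F := Submodule.reflection (ℝ ∙ (c₁ - e))ᗮ with hR
  have hRc : R c₁ = e := Submodule.reflection_sub hnorm
  set S : F ≃ₗ[ℝ] F := LinearEquiv.smulOfNeZero ℝ F ‖c‖⁻¹ (inv_ne_zero hc') with hS
  refine ⟨(S.trans R.toLinearEquiv).toContinuousLinearEquiv, ?_⟩
  show R (S c) = e
  have hSc : S c = c₁ := by
    show ((Units.mk0 ‖c‖⁻¹ (inv_ne_zero hc') : ℝˣ) • c : F) = c₁
    rw [Units.smul_mk0, hc₁]
  rw [hSc, hRc]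

variable {E : Type*} [NormedAddCommGroup E] [NormedSpace ℝ E]
  {M : Type*} [TopologicalSpace M] [ChartedSpace E M] [IsManifold 𝓘(ℝ, E) ∞ M]

/-- A chart of the maximal `C^∞` atlas of a manifold modelled on the normed space `E` itself,
followed by a continuous linear automorphism of `E`, is again a chart of the maximal `C^∞` atlas
(the linear change of coordinates in Lee 2012, Thm. 9.22). [folklore] -/
theorem transHomeomorph_continuousLinearEquiv_mem_maximalAtlas {e : OpenPartialHomeomorph M E}
    (he : e ∈ IsManifold.maximalAtlas 𝓘(ℝ, E) ∞ M) (T : E ≃L[ℝ] E) :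
    e.transHomeomorph T.toHomeomorph ∈ IsManifold.maximalAtlas 𝓘(ℝ, E) ∞ M := by
  rw [IsManifold.mem_maximalAtlas_iff_contMDiffOn, OpenPartialHomeomorph.transHomeomorph_apply,
    OpenPartialHomeomorph.transHomeomorph_symm_apply,
    OpenPartialHomeomorph.transHomeomorph_source, OpenPartialHomeomorph.transHomeomorph_target,
    ContinuousLinearEquiv.coe_toHomeomorph]
  constructor
  · exact (contMDiffOn_iff_contDiffOn.2 (T.contDiff.contDiffOn (s := univ))).comp
      (contMDiffOn_of_mem_maximalAtlas he) (fun x _ ↦ mem_preimage.2 (mem_univ _))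
  · have hT : ContMDiffOn 𝓘(ℝ, E) 𝓘(ℝ, E) ∞ (T.toHomeomorph.symm : E → E) univ := by
      rw [ContinuousLinearEquiv.coe_symm_toHomeomorph]
      exact contMDiffOn_iff_contDiffOn.2 (T.symm.contDiff.contDiffOn (s := univ))
    refine (contMDiffOn_symm_of_mem_maximalAtlas he).comp (hT.mono (subset_univ _)) ?_
    intro p hp
    simpa using hp

end LinearStraightening

/-! ### Calculus: functions with vanishing derivative along a direction -/

/-- A function with derivative `0` at every point of the segment between `0` and `t` takes the
same value at `t` and at `0` (mean value inequality with bound `0`). [folklore] -/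
private theorem eq_of_hasDerivAt_zero_of_uIcc {F : Type*} [NormedAddCommGroup F]
    [NormedSpace ℝ F] {f : ℝ → F} {t : ℝ} (h : ∀ s ∈ uIcc 0 t, HasDerivAt f 0 s) :
    f t = f 0 := by
  rcases le_total 0 t with ht | ht
  · have h' := norm_image_sub_le_of_norm_deriv_le_segment' (f' := fun _ ↦ (0 : F)) (C := 0)
      (fun s hs ↦ (h s (by rwa [uIcc_of_le ht])).hasDerivWithinAt) (fun s _ ↦ by simp) t
      (right_mem_Icc.2 ht)
    simpa [sub_eq_zero] using h'
  · have h' := norm_image_sub_le_of_norm_deriv_le_segment' (a := t) (b := 0)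
      (f' := fun _ ↦ (0 : F)) (C := 0)
      (fun s hs ↦ (h s (by rwa [uIcc_of_ge ht])).hasDerivWithinAt) (fun s _ ↦ by simp) 0
      (right_mem_Icc.2 ht)
    have h'' : f 0 = f t := by simpa [sub_eq_zero] using h'
    exact h''.symm

/-- Calculus form of stationarity: if `t ↦ F (q + t • c)` has derivative `0` at `t = 0` for
every `q ∈ S`, then `F` takes equal values at the endpoints of every segment `q + [0, t] c ⊆ S`.
[folklore] -/
theorem apply_add_smul_eq_of_hasDerivAt_zero {E' G : Type*} [NormedAddCommGroup E']
    [NormedSpace ℝ E'] [NormedAddCommGroup G] [NormedSpace ℝ G] {F : E' → G} {c : E'}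
    {S : Set E'} (hS : ∀ q ∈ S, HasDerivAt (fun t : ℝ ↦ F (q + t • c)) 0 0) {q : E'} {t : ℝ}
    (hseg : ∀ s ∈ uIcc 0 t, q + s • c ∈ S) : F (q + t • c) = F q := by
  set f : ℝ → G := fun s ↦ F (q + s • c) with hf
  have hderiv : ∀ s ∈ uIcc 0 t, HasDerivAt f 0 s := by
    intro s hs
    have h := hS (q + s • c) (hseg s hs)
    have hfun : (fun r : ℝ ↦ F (q + s • c + r • c)) = fun r ↦ f (s + r) := by
      funext r
      simp only [hf, add_smul, add_assoc]
    rw [hfun] at h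
    have h2 := HasDerivAt.comp_sub_const s s (by rw [sub_self]; exact h)
    have hfun2 : (fun x : ℝ ↦ f (s + (x - s))) = f := by
      funext x
      congr 1
      ring
    rwa [hfun2] at h2
  have h := eq_of_hasDerivAt_zero_of_uIcc hderiv
  simpa [hf] using h

/-! ### Comoving charts -/

-- Below, `𝐞₀` of the docstrings is the first coordinate vector
-- `EuclideanSpace.single (0 : Fin 4) (1 : ℝ)` of `E4 = ℝ⁴` (written out; no notation is declared).

namespace StationaryAFBlackHole

variable (𝓑 : StationaryAFBlackHole.{0})

/-- **Comoving chart about a regular point of a Killing field** (Müller zum Hagen 1970; Tod 2007,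
Thm. 3.1, chart-free form). Let `K` be a vector field on the stationary black-hole spacetime `𝓑`,
of class `C^∞` on the open set `U` and satisfying the Killing equation
`g(∇_v K, w) + g(v, ∇_w K) = 0` on `U`, and let `y ∈ U` with `K y ≠ 0`. Then there is a chart `ψ`
of the maximal `C^∞` atlas with `y ∈ ψ.source ⊆ U` in which `K` is the first coordinate vector
field `∂₀` (`dψ_x (K x) = 𝐞₀` and `d(ψ⁻¹)_{ψ x} 𝐞₀ = K x` on `ψ.source`) and in which every
metric component `p ↦ g_{ψ⁻¹ p}(dψ⁻¹_p a, dψ⁻¹_p b)` has derivative `0` in the direction `𝐞₀` at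
every point of `ψ.target` — the metric components do not depend on the coordinate `x⁰` along
`K`. [cite: MullerZumHagen1970, Theorem (step 1: comoving coordinates) = Tod 2007 Thm. 3.1] -/
theorem exists_comovingChart [𝓑.metric.HasLeviCivita] {U : Set 𝓑.carrier}
    {K : Π x : 𝓑.carrier, TangentSpace (𝓡 4) x} (hU : IsOpen U)
    (hK : ContMDiffOn (𝓡 4) ((𝓡 4).prod 𝓘(ℝ, E4)) ((⊤ : ℕ∞) : WithTop ℕ∞)
      (fun x ↦ (TotalSpace.mk' E4 x (K x) : TangentBundle (𝓡 4) 𝓑.carrier)) U)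
    (hKill : ∀ x ∈ U, ∀ v w : TangentSpace (𝓡 4) x,
      𝓑.metric.val x (𝓑.metric.leviCivita K x v) w +
        𝓑.metric.val x v (𝓑.metric.leviCivita K x w) = 0)
    {y : 𝓑.carrier} (hy : y ∈ U) (hKy : K y ≠ 0) :
    ∃ ψ ∈ IsManifold.maximalAtlas (𝓡 4) ((⊤ : ℕ∞) : WithTop ℕ∞) 𝓑.carrier,
      y ∈ ψ.source ∧ ψ.source ⊆ U ∧
      (∀ x ∈ ψ.source, mfderiv (𝓡 4) (𝓡 4) ψ x (K x) = (EuclideanSpace.single (0 : Fin 4) (1 : ℝ) : E4)) ∧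
      (∀ x ∈ ψ.source, mfderiv 𝓘(ℝ, E4) (𝓡 4) ψ.symm (ψ x) (EuclideanSpace.single (0 : Fin 4) (1 : ℝ) : E4) = K x) ∧
      ∀ q ∈ ψ.target, ∀ a b : E4,
        HasDerivAt (fun t : ℝ ↦ 𝓑.metric.val (ψ.symm (q + t • (EuclideanSpace.single (0 : Fin 4) (1 : ℝ) : E4)))
          (mfderiv 𝓘(ℝ, E4) (𝓡 4) ψ.symm (q + t • (EuclideanSpace.single (0 : Fin 4) (1 : ℝ) : E4)) a)
          (mfderiv 𝓘(ℝ, E4) (𝓡 4) ψ.symm (q + t • (EuclideanSpace.single (0 : Fin 4) (1 : ℝ) : E4)) b)) 0 0 := by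
  -- the flow box: `K` is the constant field `c = K y` in a chart `ψ₀`
  obtain ⟨ψ₀, hψ₀, hyψ₀, hψ₀U, hKψ₀, hKψ₀'⟩ :=
    Literature.Geometry.Manifold.exists_chart_mfderiv_eq_const (E := E4) hU hK hy hKy
  obtain ⟨c, hc⟩ : ∃ c : E4, c = K y := ⟨_, rfl⟩
  rw [← hc] at hKψ₀ hKψ₀' hKy
  -- a linear change of coordinates taking `c` to `𝐞₀`
  have he₀ : ‖(EuclideanSpace.single (0 : Fin 4) (1 : ℝ) : E4)‖ = 1 := by simp
  obtain ⟨T, hT⟩ := exists_continuousLinearEquiv_apply_eq (F := E4) hKy he₀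
  have hT' : T.symm (EuclideanSpace.single (0 : Fin 4) (1 : ℝ) : E4) = c := by rw [← hT, T.symm_apply_apply]
  set ψ := ψ₀.transHomeomorph T.toHomeomorph with hψdef
  have hψ : ψ ∈ IsManifold.maximalAtlas (𝓡 4) ((⊤ : ℕ∞) : WithTop ℕ∞) 𝓑.carrier :=
    transHomeomorph_continuousLinearEquiv_mem_maximalAtlas hψ₀ T
  have hsrc : ψ.source = ψ₀.source := OpenPartialHomeomorph.transHomeomorph_source _ _
  have hψapp : ∀ x, ψ x = T (ψ₀ x) := fun x ↦ rfl
  have hψsymm : ∀ p, ψ.symm p = ψ₀.symm (T.symm p) := fun p ↦ rfl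
  -- differentiability of the two factors
  have hd₀ := mdifferentiable_of_mem_maximalAtlas' hψ₀
  have hTd : ∀ p : E4, MDifferentiableAt 𝓘(ℝ, E4) 𝓘(ℝ, E4) (T : E4 → E4) p := fun p ↦
    T.hasMFDerivAt.mdifferentiableAt
  have hTd' : ∀ p : E4, MDifferentiableAt 𝓘(ℝ, E4) 𝓘(ℝ, E4) (T.symm : E4 → E4) p := fun p ↦
    T.symm.hasMFDerivAt.mdifferentiableAt
  -- `dψ (K x) = T (dψ₀ (K x)) = T c = 𝐞₀`
  have h1 : ∀ x ∈ ψ.source, mfderiv (𝓡 4) (𝓡 4) ψ x (K x) = (EuclideanSpace.single (0 : Fin 4) (1 : ℝ) : E4) := by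
    intro x hx
    rw [hsrc] at hx
    have hcomp : (ψ : 𝓑.carrier → E4) = (T : E4 → E4) ∘ ψ₀ := funext hψapp
    rw [hcomp, mfderiv_comp x (hTd _) (hd₀.mdifferentiableAt hx), T.mfderiv_eq]
    show T (mfderiv (𝓡 4) (𝓡 4) ψ₀ x (K x)) = (EuclideanSpace.single (0 : Fin 4) (1 : ℝ) : E4)
    rw [hKψ₀ x hx, hT]
  -- `dψ⁻¹ (EuclideanSpace.single (0 : Fin 4) (1 : ℝ) : E4) = dψ₀⁻¹ (T⁻¹ (EuclideanSpace.single (0 : Fin 4) (1 : ℝ) : E4)) = dψ₀⁻¹ c = K x`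
  have h2 : ∀ x ∈ ψ.source, mfderiv 𝓘(ℝ, E4) (𝓡 4) ψ.symm (ψ x) (EuclideanSpace.single (0 : Fin 4) (1 : ℝ) : E4) = K x := by
    intro x hx
    rw [hsrc] at hx
    have hcomp : (ψ.symm : E4 → 𝓑.carrier) = ψ₀.symm ∘ (T.symm : E4 → E4) := funext hψsymm
    have hpt : T.symm (ψ x) = ψ₀ x := by rw [hψapp, T.symm_apply_apply]
    have hd : MDifferentiableAt 𝓘(ℝ, E4) (𝓡 4) ψ₀.symm (T.symm (ψ x)) := by
      rw [hpt]
      exact hd₀.mdifferentiableAt_symm (ψ₀.map_source hx)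
    rw [hcomp, mfderiv_comp (ψ x) hd (hTd' _), T.symm.mfderiv_eq]
    show mfderiv 𝓘(ℝ, E4) (𝓡 4) ψ₀.symm (T.symm (ψ x)) (T.symm (EuclideanSpace.single (0 : Fin 4) (1 : ℝ) : E4)) = K x
    rw [hT', hpt]
    exact hKψ₀' x hx
  refine ⟨ψ, hψ, by rwa [hsrc], hsrc ▸ hψ₀U, h1, h2, fun q hq a b ↦ ?_⟩
  obtain ⟨x, hx, rfl⟩ : ∃ x ∈ ψ.source, ψ x = q := ⟨ψ.symm q, ψ.map_target hq, ψ.right_inv hq⟩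
  exact PseudoRiemannianMetric.hasDerivAt_val_coordVector_of_killing_at
    (g := 𝓑.metric.toPseudoRiemannianMetric) hψ (c := (EuclideanSpace.single (0 : Fin 4) (1 : ℝ) : E4)) h2 hx
    (hKill x ((hsrc ▸ hψ₀U) hx)) a b

/-- A timelike vector is non-zero. [folklore] -/
theorem ne_zero_of_val_self_neg {y : 𝓑.carrier} {v : TangentSpace (𝓡 4) y}
    (hv : 𝓑.metric.val y v v < 0) : v ≠ 0 := by
  rintro rfl
  simp at hv

/-- **Comoving chart about a point where the Killing field is timelike** — the hypotheses of the
named fact `mullerZumHagen1970_analytic_of_timelikeKilling` (Müller zum Hagen 1970; Tod 2007,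
Thm. 3.1): as `exists_comovingChart`, about every `y ∈ U` with `g(K, K)(y) < 0`.
[cite: MullerZumHagen1970, Theorem (step 1: comoving coordinates) = Tod 2007 Thm. 3.1] -/
theorem exists_comovingChart_of_timelike [𝓑.metric.HasLeviCivita] {U : Set 𝓑.carrier}
    {K : Π x : 𝓑.carrier, TangentSpace (𝓡 4) x} (hU : IsOpen U)
    (hK : ContMDiffOn (𝓡 4) ((𝓡 4).prod 𝓘(ℝ, E4)) ((⊤ : ℕ∞) : WithTop ℕ∞)
      (fun x ↦ (TotalSpace.mk' E4 x (K x) : TangentBundle (𝓡 4) 𝓑.carrier)) U)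
    (hKill : ∀ x ∈ U, ∀ v w : TangentSpace (𝓡 4) x,
      𝓑.metric.val x (𝓑.metric.leviCivita K x v) w +
        𝓑.metric.val x v (𝓑.metric.leviCivita K x w) = 0)
    {y : 𝓑.carrier} (hy : y ∈ U) (hKy : 𝓑.metric.val y (K y) (K y) < 0) :
    ∃ ψ ∈ IsManifold.maximalAtlas (𝓡 4) ((⊤ : ℕ∞) : WithTop ℕ∞) 𝓑.carrier,
      y ∈ ψ.source ∧ ψ.source ⊆ U ∧
      (∀ x ∈ ψ.source, mfderiv (𝓡 4) (𝓡 4) ψ x (K x) = (EuclideanSpace.single (0 : Fin 4) (1 : ℝ) : E4)) ∧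
      (∀ x ∈ ψ.source, mfderiv 𝓘(ℝ, E4) (𝓡 4) ψ.symm (ψ x) (EuclideanSpace.single (0 : Fin 4) (1 : ℝ) : E4) = K x) ∧
      ∀ q ∈ ψ.target, ∀ a b : E4,
        HasDerivAt (fun t : ℝ ↦ 𝓑.metric.val (ψ.symm (q + t • (EuclideanSpace.single (0 : Fin 4) (1 : ℝ) : E4)))
          (mfderiv 𝓘(ℝ, E4) (𝓡 4) ψ.symm (q + t • (EuclideanSpace.single (0 : Fin 4) (1 : ℝ) : E4)) a)
          (mfderiv 𝓘(ℝ, E4) (𝓡 4) ψ.symm (q + t • (EuclideanSpace.single (0 : Fin 4) (1 : ℝ) : E4)) b)) 0 0 :=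
  𝓑.exists_comovingChart hU hK hKill hy (𝓑.ne_zero_of_val_self_neg hKy)

/-- **Stationarity of the metric components in a comoving chart** (integrated form of
`exists_comovingChart`; Müller zum Hagen 1970 / Tod 2007, Thm. 3.1: "`F`, `A_i`, `h_{ij}`
independent of `t`"). If in the chart `ψ` every metric component has derivative `0` along `c` at
every point of `ψ.target`, then the components take equal values at the endpoints of every
segment `q + [0, t] c` contained in `ψ.target`. [cite: MullerZumHagen1970, Theorem (step 1) = Tod 2007 Thm. 3.1] -/
theorem val_coordVector_eq_of_segment {ψ : OpenPartialHomeomorph 𝓑.carrier E4} {c : E4}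
    (hψ : ∀ q ∈ ψ.target, ∀ a b : E4,
      HasDerivAt (fun t : ℝ ↦ 𝓑.metric.val (ψ.symm (q + t • c))
        (mfderiv 𝓘(ℝ, E4) (𝓡 4) ψ.symm (q + t • c) a)
        (mfderiv 𝓘(ℝ, E4) (𝓡 4) ψ.symm (q + t • c) b)) 0 0)
    {q : E4} {t : ℝ} (hseg : ∀ s ∈ uIcc 0 t, q + s • c ∈ ψ.target) (a b : E4) :
    𝓑.metric.val (ψ.symm (q + t • c)) (mfderiv 𝓘(ℝ, E4) (𝓡 4) ψ.symm (q + t • c) a)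
        (mfderiv 𝓘(ℝ, E4) (𝓡 4) ψ.symm (q + t • c) b) =
      𝓑.metric.val (ψ.symm q) (mfderiv 𝓘(ℝ, E4) (𝓡 4) ψ.symm q a)
        (mfderiv 𝓘(ℝ, E4) (𝓡 4) ψ.symm q b) :=
  apply_add_smul_eq_of_hasDerivAt_zero
    (F := fun p : E4 ↦ 𝓑.metric.val (ψ.symm p) (mfderiv 𝓘(ℝ, E4) (𝓡 4) ψ.symm p a)
      (mfderiv 𝓘(ℝ, E4) (𝓡 4) ψ.symm p b))
    (fun q' hq' ↦ hψ q' hq' a b) hseg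

end StationaryAFBlackHole

end Literature.Geometry.Lorentzian
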